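import Mathlib
import Literature.Computability.AlgebraicComplexity.ReadKDeterminantalRepresentationsProofs

/-!
# Crux `PrincipalMinorColouring.BorderBoundedRankTwo` (stmt-ValiantsHypothesis-21038), line `closure_counting` —
# stub `stub_denseCount`: the dense-image parameter count (definition-free core)

The registered stub `stub_denseCount` of the skeleton `Cruxes/BorderBoundedRankTwo/Lines/closure_counting.lean`
(planner val-width-lines-2) reads: if EVERY vector `c : (Fin k → Bool) → ℂ` lies in the closure of the union
`NFImage k` of the images of the Hrubeš–Joglekar normal-form coefficient maps
`(a, H) ↦ (r ↦ coeff_{x^r} (a · det (diag(X_{ι 1}, …, X_{ι s}, 0, …, 0) + H)))` over all slot patterns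
`ι : Fin s → Fin k`, `s ≤ 2k`, then `2 ^ k ≤ 1 + (4k)²`.

This file proves it with the skeleton's definitions `monB`, `nfMap`, `NFImage` UNFOLDED
(`two_pow_le_of_dense_normalFormImages`; the verbatim-signature wrapper lives in the companion file
`…BorderBoundedRankTwoStubDenseCount`, which imports the Theorems-side copy of the definitions), through a general,
closure-robust form of Hrubeš–Joglekar 2025, Thm. 2 (`card_le_of_dense_of_subset_polynomialImages`): over an infinite
T₁ topological field, if a set `S ⊆ F^ρ` is covered by the images of finitely many polynomial maps with at most `N`
parameters each and `S` is DENSE, then `|ρ| ≤ N` — each image has a nonzero polynomial annihilator when `N < |ρ|`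
(`exists_aeval_eq_zero_of_card_lt`, transcendence degree), the product of the annihilators vanishes on `S`, its zero
set is closed (`MvPolynomial.continuous_eval`) hence contains `closure S = F^ρ`, contradicting `MvPolynomial.funext`.
The normal-form coefficient maps are polynomial in the `1 + (2s)²` parameters `(a, H)`
(`eval_coeff_genericNormalForm`, the generic scaled determinant, as in the tree's
`two_pow_le_of_forall_exists_normalForm`).

Prover seat val-width-21038-p2 g0. No definitions. Closes NO item (`--supports stmt-ValiantsHypothesis-21038`).
WHAT THIS IS NOT: not `stub_transport` (the closure transport from border membership to `NFImage`), not the crux;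
VP ≠ VNP is not moved.
-/

-- `Summit.ValiantsHypothesis.ValiantsHypothesis.…` is the tree's mandated single-conjunct layout (Sub = Summit).
set_option linter.dupNamespace false

namespace Summit.ValiantsHypothesis.ValiantsHypothesis.Theorems.PrincipalMinorColouring.ClosureCounting

open MvPolynomial Matrix
open Literature.Computability.AlgebraicComplexity

/-! ### Dense finite unions of polynomial images have enough parameters -/

/-- **Closure-robust parameter count** (Hrubeš–Joglekar 2025, Thm. 2, border form). Over an infinite T₁
topological field `F`: if every point of `S ⊆ F^ρ` is a value `(r ↦ Q i r (x))` of one of finitely many polynomial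
maps `F^{π i} → F^ρ` with `|π i| ≤ N`, and `S` is dense in `F^ρ` (product topology), then `|ρ| ≤ N`.
[cite: HrubesJoglekar2025, Thm. 2 (p. 53:4)] -/
theorem card_le_of_dense_of_subset_polynomialImages {F : Type*} [Field F] [TopologicalSpace F]
    [IsTopologicalSemiring F] [T1Space F] [Infinite F] {ρ : Type*} [Fintype ρ] {I : Type*} [Finite I]
    {π : I → Type*} [∀ i, Fintype (π i)] (Q : (i : I) → ρ → MvPolynomial (π i) F) {N : ℕ}
    (hN : ∀ i, Fintype.card (π i) ≤ N) (S : Set (ρ → F))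
    (hS : ∀ v ∈ S, ∃ (i : I) (x : π i → F), (fun r => eval x (Q i r)) = v)
    (hdense : ∀ v : ρ → F, v ∈ closure S) :
    Fintype.card ρ ≤ N := by
  classical
  by_contra hlt
  push Not at hlt
  -- every image has a nonzero polynomial annihilator
  have hrel : ∀ i, ∃ P : MvPolynomial ρ F, P ≠ 0 ∧
      ∀ x : π i → F, eval (fun r => eval x (Q i r)) P = 0 := by
    intro i
    obtain ⟨P, hP0, hP⟩ := exists_aeval_eq_zero_of_card_lt (lt_of_le_of_lt (hN i) hlt) (Q i)
    refine ⟨P, hP0, fun x => ?_⟩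
    have hev : eval x (aeval (Q i) P) = eval (fun r => eval x (Q i r)) P := by
      rw [aeval_eq_bind₁]
      exact eval₂Hom_bind₁ _ _ _ _
    rw [← hev, hP, map_zero]
  choose P hP0 hP using hrel
  haveI := Fintype.ofFinite I
  -- their product is nonzero and vanishes on `S`
  have hprod0 : (∏ i, P i) ≠ 0 := Finset.prod_ne_zero_iff.2 fun i _ => hP0 i
  have hvan : S ⊆ (fun v : ρ → F => eval v (∏ i, P i)) ⁻¹' {0} := by
    intro v hv
    obtain ⟨i, x, rfl⟩ := hS v hv
    rw [Set.mem_preimage, Set.mem_singleton_iff, map_prod]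
    exact Finset.prod_eq_zero (Finset.mem_univ i) (hP i x)
  -- the zero set is closed, hence contains the closure of `S`, i.e. everything
  have hclosed : IsClosed ((fun v : ρ → F => eval v (∏ i, P i)) ⁻¹' {0}) :=
    isClosed_singleton.preimage (MvPolynomial.continuous_eval _)
  have hsub := closure_minimal hvan hclosed
  apply hprod0
  apply MvPolynomial.funext
  intro v
  have hv := hsub (hdense v)
  rw [Set.mem_preimage, Set.mem_singleton_iff] at hv
  rw [hv, map_zero]

/-! ### The normal-form coefficient maps are polynomial maps -/

/-- The coefficients of `a · det (diag(X_{ι 1}, …, X_{ι s}, 0, …, 0) + H)` are the values at the parameter point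
`(a, H)` of the coefficients of the GENERIC scaled normal form `A · det (diag(X_ι, 0) + (Y_{ij}))`, a polynomial in
the variables `τ ⊕ (Unit ⊕ (2s × 2s))`. -/
theorem eval_coeff_genericNormalForm {F : Type*} [CommRing F] {τ : Type*} {s : ℕ} (ι : Fin s → τ)
    (m : τ →₀ ℕ) (a : F) (H : Matrix (Fin s ⊕ Fin s) (Fin s ⊕ Fin s) F) :
    eval (Sum.elim (fun _ : Unit => a) (fun ab : (Fin s ⊕ Fin s) × (Fin s ⊕ Fin s) => H ab.1 ab.2))
        (coeff m (sumAlgEquiv F τ (Unit ⊕ ((Fin s ⊕ Fin s) × (Fin s ⊕ Fin s)))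
          (X (Sum.inr (Sum.inl ())) *
            (diagonal (Sum.elim (fun q => X (Sum.inl (ι q))) 0) +
              Matrix.of fun i j => X (Sum.inr (Sum.inr (i, j)))).det))) =
      coeff m (C a * (diagonal (Sum.elim (fun q => (X (ι q) : MvPolynomial τ F)) 0) +
        H.map (fun b : F => (C b : MvPolynomial τ F))).det) := by
  rw [eval_coeff_sumAlgEquiv]
  congr 1
  rw [map_mul, aeval_X, Sum.elim_inr, Sum.elim_inl, AlgHom.map_det]
  congr 2
  ext i j
  rw [AlgHom.mapMatrix_apply, Matrix.map_apply, Matrix.add_apply, Matrix.add_apply, map_add,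
    Matrix.of_apply, aeval_X, Sum.elim_inr, Sum.elim_inr, Matrix.map_apply, diagonal_apply,
    diagonal_apply]
  congr 1
  split_ifs with hij
  · rcases i with q | q
    · simp
    · simp
  · rw [map_zero]

/-! ### The stub, with the skeleton's definitions unfolded -/

/-- **`stub_denseCount`, unfolded form** (line `closure_counting`, crux `BorderBoundedRankTwo`,
stmt-ValiantsHypothesis-21038): if every `c : (Fin k → Bool) → ℂ` lies in the closure of
`NFImage k = ⋃_{s ≤ 2k} ⋃_{ι : Fin s → Fin k} range (nfMap k s ι)` — the union of the images of the normal-form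
coefficient maps `(a, H) ↦ (r ↦ coeff_{monB r} (a · det (diag(X_ι, 0) + H)))`, written out here exactly as the
skeleton defines `monB`, `nfMap`, `NFImage` — then `2 ^ k ≤ 1 + (2·(2k))²`.
[cite: HrubesJoglekar2025, Thm. 2 (p. 53:4)] -/
theorem two_pow_le_of_dense_normalFormImages (k : ℕ)
    (h : ∀ c : (Fin k → Bool) → ℂ, c ∈ closure (⋃ (s : Fin (2 * k + 1)), ⋃ (ι : Fin (s : ℕ) → Fin k),
      Set.range (fun (p : ℂ × Matrix (Fin (s : ℕ) ⊕ Fin (s : ℕ)) (Fin (s : ℕ) ⊕ Fin (s : ℕ)) ℂ)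
        (r : Fin k → Bool) =>
          coeff (∑ i ∈ Finset.univ.filter (fun i => r i = true), Finsupp.single i 1)
            (C p.1 * (diagonal (Sum.elim (fun q => (X (ι q) : MvPolynomial (Fin k) ℂ)) 0) +
              p.2.map (fun a : ℂ => (C a : MvPolynomial (Fin k) ℂ))).det)))) :
    2 ^ k ≤ 1 + (2 * (2 * k)) ^ 2 := by
  classical
  have hcard := card_le_of_dense_of_subset_polynomialImages
    (I := Σ s : Fin (2 * k + 1), (Fin (s : ℕ) → Fin k))
    (π := fun i => Unit ⊕ ((Fin (i.1 : ℕ) ⊕ Fin (i.1 : ℕ)) × (Fin (i.1 : ℕ) ⊕ Fin (i.1 : ℕ))))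
    (fun i r => coeff (∑ j ∈ Finset.univ.filter (fun j => r j = true), Finsupp.single j 1)
      (sumAlgEquiv ℂ (Fin k) (Unit ⊕ ((Fin (i.1 : ℕ) ⊕ Fin (i.1 : ℕ)) × (Fin (i.1 : ℕ) ⊕ Fin (i.1 : ℕ))))
        (X (Sum.inr (Sum.inl ())) *
          (diagonal (Sum.elim (fun q => X (Sum.inl (i.2 q))) 0) +
            Matrix.of fun a b => X (Sum.inr (Sum.inr (a, b)))).det)))
    (N := 1 + (2 * (2 * k)) ^ 2) ?_ _ ?_ h
  · simpa [Fintype.card_fun, Fintype.card_bool, Fintype.card_fin] using hcard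
  · -- parameter count: `1 + (2s)² ≤ 1 + (4k)²` for `s ≤ 2k`
    rintro ⟨s, ι⟩
    have h2 : (s : ℕ) + s ≤ 2 * (2 * k) := by omega
    calc Fintype.card (Unit ⊕ ((Fin (s : ℕ) ⊕ Fin (s : ℕ)) × (Fin (s : ℕ) ⊕ Fin (s : ℕ))))
        = 1 + ((s : ℕ) + s) * ((s : ℕ) + s) := by
          simp [Fintype.card_sum, Fintype.card_prod, Fintype.card_fin, Fintype.card_unique]
      _ ≤ 1 + (2 * (2 * k)) * (2 * (2 * k)) := Nat.add_le_add_left (Nat.mul_le_mul h2 h2) 1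
      _ = 1 + (2 * (2 * k)) ^ 2 := by rw [pow_two]
  · -- every point of the union is a value of the corresponding generic coefficient map
    intro v hv
    simp only [Set.mem_iUnion, Set.mem_range] at hv
    obtain ⟨s, ι, p, rfl⟩ := hv
    refine ⟨⟨s, ι⟩, Sum.elim (fun _ => p.1) (fun ab => p.2 ab.1 ab.2), ?_⟩
    funext r
    exact eval_coeff_genericNormalForm ι _ p.1 p.2

end Summit.ValiantsHypothesis.ValiantsHypothesis.Theorems.PrincipalMinorColouring.ClosureCounting
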